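import Mathlib.Analysis.Calculus.InverseFunctionTheorem.ContDiff
import Mathlib.Analysis.Calculus.ContDiff.RCLike
import Mathlib.LinearAlgebra.FiniteDimensional.Lemmas
import Mathlib.Topology.Algebra.Module.FiniteDimension
import HarnessLib

/-!
# NE7LocalSlice — THE LOCAL SLICE THEOREM FROM AN INFINITESIMALLY FREE ACTION (abstract, finite-dimensional): `A : 𝔊 × S → S` of class `C²` at `0` with `A 0 = 0`, `∂_Φ A(0) = id`
# (the identity element acts trivially to first order … exactly: `A(0,Φ) = Φ`), and `D := ∂_ζ A(0) : 𝔊 → S`; for a subspace `𝔊₁ ≤ 𝔊` on which `D` is injective and a complement `Σ`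
# of `D(𝔊₁)` in `S`, the map `(ζ, σ) ↦ A(ζ, σ)` is a local `C²` diffeomorphism `𝔊₁ × Σ ≅ S` at `0`: every `Φ` near `0` is `A(ξ(Φ), σ(Φ))` with `ξ, σ` of class `C²`, zero at `0`,
# uniquely near `0` — with `A(ζ,Φ) = coord((chart_W Φ)^{exp ζ})` (✓ `NE7GaugeActionChart`, `D = −∇_W`) this is the gauge slice of the C¹ rung (ROAD-G114 §7 (P3))

Cell `pub-balaban`, rung (B)+1 sub-cell t4, lineage `b2b-balaban-t4-ne7-p1` (CRUX PROVER NE7 #1 = OWNER of BINDER row NE7), generation 114.  Memo `t4/b2b-balaban-t4-ne7-p1-g114/ROAD-G114.md` §7.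
THE ARGUMENT.  `DΞ(0)(ζ̇, σ̇) = Dζ̇ + σ̇`; injective since `D(𝔊₁) ⊓ Σ = ⊥` and `D` is injective on `𝔊₁`; `dim 𝔊₁ + dim Σ = dim D(𝔊₁) + dim Σ = dim S` (`IsCompl`); Mathlib's `C^n` inverse function theorem.
WHAT ([folklore]; 0 def, 0 sorry).  **`local_slice`**.
HONEST FRAMING (page 1): abstract finite-dimensional calculus; nothing of Bałaban's; NOT NE7, NOT NE3; spine 0∕9; finite T⁴ rung (B)+1 — NOT infinite volume, NOT mass gap, NOT BetaPertH, NOT Clay.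
-/

set_option autoImplicit false

open scoped Topology
open Set Filter Metric Module

namespace Summit.QuantumFields.BalabanUV.T4Continuum.NE7LocalSlice

variable {G S : Type*} [NormedAddCommGroup G] [NormedSpace ℝ G] [FiniteDimensional ℝ G] [NormedAddCommGroup S] [NormedSpace ℝ S] [FiniteDimensional ℝ S]

set_option maxHeartbeats 800000 in
/-- **THE LOCAL SLICE THEOREM (abstract).**  `A : G × S → S` `C²` at `0`, `A 0 = 0`, with `(fderiv A 0) ∘ inr = id`; `D := (fderiv A 0) ∘ inl`; `G₁ ≤ G` with `D` injective on `G₁`; `Σ ≤ S` with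
`IsCompl (G₁.map D) Σ`.  THEN `∃ ξ : S → G₁, σ : S → Σ`, both `C²` at `0` and zero at `0`, with `∀ᶠ Φ, A (ξ Φ, σ Φ) = Φ` and `∀ᶠ q : G₁ × Σ, (ξ (A (q.1, q.2)), σ (A (q.1, q.2))) = q`. [folklore] -/
theorem local_slice {A : G × S → S} (hAc : ContDiffAt ℝ 2 A 0) (hA0 : A 0 = 0)
    (hAΦ : (fderiv ℝ A 0).comp (ContinuousLinearMap.inr ℝ G S) = ContinuousLinearMap.id ℝ S)
    (G₁ : Submodule ℝ G) (Sg : Submodule ℝ S)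
    (hinj : ∀ ζ ∈ G₁, ((fderiv ℝ A 0).comp (ContinuousLinearMap.inl ℝ G S)) ζ = 0 → ζ = 0)
    (hcompl : IsCompl (G₁.map (((fderiv ℝ A 0).comp (ContinuousLinearMap.inl ℝ G S) : G →L[ℝ] S) : G →ₗ[ℝ] S)) Sg) :
    ∃ (ξ : S → ↥G₁) (σ : S → ↥Sg), ContDiffAt ℝ 2 ξ 0 ∧ ContDiffAt ℝ 2 σ 0 ∧ ξ 0 = 0 ∧ σ 0 = 0 ∧
      (∀ᶠ Φ : S in 𝓝 0, A ((ξ Φ : G), (σ Φ : S)) = Φ) ∧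
      (∀ᶠ q : ↥G₁ × ↥Sg in 𝓝 0, ξ (A ((q.1 : G), (q.2 : S))) = q.1 ∧ σ (A ((q.1 : G), (q.2 : S))) = q.2) := by
  haveI : CompleteSpace (↥G₁ × ↥Sg) := FiniteDimensional.complete ℝ _
  set T : G × S →L[ℝ] S := fderiv ℝ A 0 with hT
  set D : G →L[ℝ] S := T.comp (ContinuousLinearMap.inl ℝ G S) with hD
  have hAd : HasFDerivAt A T 0 := (hAc.differentiableAt (by norm_num)).hasFDerivAt
  -- `Ξ(ζ, σ) = A(ζ, σ)` on `G₁ × Σ`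
  set ι : ↥G₁ × ↥Sg →L[ℝ] G × S := G₁.subtypeL.prodMap Sg.subtypeL with hι
  set Ξ : ↥G₁ × ↥Sg → S := fun q => A (ι q) with hΞ
  have hΞq : ∀ q : ↥G₁ × ↥Sg, Ξ q = A ((q.1 : G), (q.2 : S)) := fun q => rfl
  have hΞc : ContDiffAt ℝ 2 Ξ 0 := by
    have h : ContDiffAt ℝ 2 A (ι 0) := by rw [map_zero]; exact hAc
    exact h.comp 0 ι.contDiff.contDiffAt
  have hΞd : HasFDerivAt Ξ (T.comp ι) 0 := by
    have h : HasFDerivAt A T (ι 0) := by rw [map_zero]; exact hAd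
    exact h.comp 0 ι.hasFDerivAt
  -- `T(ζ̇, σ̇) = D ζ̇ + σ̇`
  have hTsplit : ∀ (ζ : G) (s : S), T (ζ, s) = D ζ + s := by
    intro ζ s
    have e1 : ((ζ, s) : G × S) = (ContinuousLinearMap.inl ℝ G S) ζ + (ContinuousLinearMap.inr ℝ G S) s := by simp
    have e2 : T ((ContinuousLinearMap.inr ℝ G S) s) = s := by
      have h := congrArg (fun L : S →L[ℝ] S => L s) hAΦ
      simpa using h
    rw [e1, map_add, e2]
    rfl
  -- injectivity of the differential
  have hΞinj : Function.Injective (T.comp ι) := by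
    refine (injective_iff_map_eq_zero _).mpr fun q hq => ?_
    obtain ⟨ζ, s⟩ := q
    have hq' : D (ζ : G) + (s : S) = 0 := by rw [← hTsplit]; exact hq
    have hDmem : D (ζ : G) ∈ G₁.map (D : G →ₗ[ℝ] S) := ⟨ζ, ζ.2, rfl⟩
    have hsmem : (s : S) ∈ Sg := s.2
    -- `D ζ = -s ∈ map ⊓ Σ = ⊥`
    have hDζ : D (ζ : G) = 0 := by
      have hneg : D (ζ : G) = -(s : S) := eq_neg_of_add_eq_zero_left hq'
      have hin : D (ζ : G) ∈ G₁.map (D : G →ₗ[ℝ] S) ⊓ Sg := ⟨hDmem, by rw [hneg]; exact Sg.neg_mem hsmem⟩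
      rw [hcompl.inf_eq_bot, Submodule.mem_bot] at hin
      exact hin
    have hζ : (ζ : G) = 0 := hinj _ ζ.2 hDζ
    have hs : (s : S) = 0 := by rw [hDζ, zero_add] at hq'; exact hq'
    have hζ' : ζ = 0 := Subtype.ext (by simpa using hζ)
    have hs' : s = 0 := Subtype.ext (by simpa using hs)
    simp [hζ', hs']
  -- dimension count
  have hdim : finrank ℝ (↥G₁ × ↥Sg) = finrank ℝ S := by
    have h1 := Submodule.finrank_add_eq_of_isCompl hcompl
    have h2 : finrank ℝ ↥(G₁.map (D : G →ₗ[ℝ] S)) = finrank ℝ ↥G₁ := by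
      have hinj' : Function.Injective ((D : G →ₗ[ℝ] S).domRestrict G₁) := by
        refine (injective_iff_map_eq_zero _).mpr fun ζ hζ => ?_
        exact Subtype.ext (hinj _ ζ.2 (by simpa using hζ))
      rw [← LinearMap.range_domRestrict, LinearMap.finrank_range_of_inj hinj']
    rw [Module.finrank_prod, ← h2]
    exact h1
  set eL : (↥G₁ × ↥Sg) ≃ₗ[ℝ] S := LinearMap.linearEquivOfInjective ((T.comp ι : ↥G₁ × ↥Sg →L[ℝ] S) : ↥G₁ × ↥Sg →ₗ[ℝ] S) hΞinj hdim with heL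
  set e : (↥G₁ × ↥Sg) ≃L[ℝ] S := eL.toContinuousLinearEquiv with he
  have hecoe : (e : ↥G₁ × ↥Sg →L[ℝ] S) = T.comp ι := by
    ext q
    · rfl
    · rfl
  have hΞe : HasFDerivAt Ξ (e : ↥G₁ × ↥Sg →L[ℝ] S) 0 := by rw [hecoe]; exact hΞd
  -- the inverse function theorem
  have hs := hΞc.hasStrictFDerivAt' hΞe two_ne_zero
  have hΞ0 : Ξ 0 = 0 := by simp [hΞ, hA0]
  set inv := hs.localInverse Ξ e 0 with hinv
  have hinvc : ContDiffAt ℝ 2 inv (Ξ 0) := hΞc.to_localInverse hΞe two_ne_zero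
  rw [hΞ0] at hinvc
  have hleft : ∀ᶠ q : ↥G₁ × ↥Sg in 𝓝 0, inv (Ξ q) = q := hs.eventually_left_inverse
  have hright : ∀ᶠ Φ : S in 𝓝 0, Ξ (inv Φ) = Φ := by have h := hs.eventually_right_inverse; rwa [hΞ0] at h
  have hinv0 : inv 0 = 0 := by have := hs.localInverse_apply_image; rwa [hΞ0] at this
  refine ⟨fun Φ => (inv Φ).1, fun Φ => (inv Φ).2, contDiffAt_fst.comp 0 hinvc, contDiffAt_snd.comp 0 hinvc, by simp [hinv0], by simp [hinv0], ?_, ?_⟩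
  · filter_upwards [hright] with Φ hΦ
    rw [← hΞq]; exact hΦ
  · filter_upwards [hleft] with q hq
    rw [← hΞq, hq]
    exact ⟨rfl, rfl⟩

end Summit.QuantumFields.BalabanUV.T4Continuum.NE7LocalSlice
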